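import Literature.NumberTheory.EllipticCurves.KubertTateFiveMuDescentBox
import Literature.NumberTheory.EllipticCurves.KubertTateFiveRationalTorsion
import HarnessLib

/-!
# `t₅ = 0` at rank `1` by descent alone: the Kubert–Tate curve `E_{13/3} = [-10, -39, -117, 0, 0]`

PROOF-ONLY file (theorems only, no definition, no named fact, no `sorry`), topic
`NumberTheory/EllipticCurves`; an INSTANCE of the `μ₅`-descent box criterion
(`KubertTateMuDescent.shaCorank_five_eq_zero_of_matrix` and siblings, files `KubertTateFiveMuDescent[Box]`) on the
Kubert–Tate `X₁(5)`-family `E_{m,n} : y² + (n − m)xy − mn²y = x³ − mnx²`, at `(m, n) = (13, 3)`: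

  `E = E_{13/3} = kubertTateFive (13) 3 = [-10, -39, -117, 0, 0]`, i.e. `y ^ 2 - 10 * x * y - 117 * y = x ^ 3 - 39 * x ^ 2`,
  `Δ = -3⁵·13⁵·269 = (mn)⁵ (m² − 11mn − n²)`, `T = (0,0)` of order `5`, `5` good (`a₅ = 1`).

TAME: `5 ∤ Δ` and the bad primes `3, 13, 269` are `≢ 1 (mod 5)` (and GAUSSIAN-tame: `269 ≡ 4 (mod 5)` is `≡ 1 (mod 4)`).
BOX: `S = {3, 13}` (`ω(mn) = 2`); the rational points `−T = (0, 117)` and `(105, 1617)` have `f_T = xy − 3x² + 9y` equal to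
`1053 = 3⁴·13` and `151263 = 3²·7⁵`; the base point `2T = (39, 507)` has `f_T = 19773 = 3²·13³`; the `2×2` matrix of
valuation differences mod `5`, `M = [[2, 3], [0, 2]]`, is invertible mod `5` (inverse `[[3, 3], [0, 3]]`). Hence, with NO
`L`-function, `p`-adic or conjectural input:

* `shaCorank_five_eq_zero` — **`t₅(E_{13/3}) = corank_{ℤ₅} Ш(E/ℚ)[5^∞] = 0`**;
* `sha_torsionBy_five_eq_bot` — `Ш(E/ℚ)[5] = 0`; `primaryComponent_sha_five_eq_bot` — `Ш(E/ℚ)[5^∞] = 0`;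
* `mordellWeilRank_eq` — **`rank E_{13/3}(ℚ) = 1`** (`#E(ℚ)[5] = 5` by reduction modulo `2`).

`mn = 39 = 3·13` with `13 ≡ 1 (mod 4)` SPLIT in `ℤ[i]`: this is the `ℚ`-side of a `5`-descent over `ℚ(i)` whose twist side
has rank `1` (sequel `KubertTate133GaussianDescent`).  BSD is not proved by this.

## References

* [SilvermanAEC2009] J. H. Silverman, *AEC*, 2nd ed., Thm. X.4.2, Prop. X.4.9, Exercise 10.1, Thm. X.1.1, VII.3.1(b).
* [Fisher2001FiveSevenDescent] T. Fisher, JEMS 3 (2001), §§1–2 (the family; this member and its points are ours).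
* [Kubert1976] D. S. Kubert, *Universal bounds on the torsion of elliptic curves*, Table 3 (`N = 5`).
-/

noncomputable section

open scoped AddSubgroup
open WeierstrassCurve
open Literature.NumberTheory.EllipticCurves Literature.NumberTheory.EllipticCurves.KubertTateVelu

namespace Literature.NumberTheory.EllipticCurves

namespace KubertTate133Descent

/-! ## §1 The curve: coefficients, discriminant, tameness -/

/-- `E_{13/3} = [-10, -39, -117, 0, 0]`. [cite: Kubert1976, Table 3 (N = 5)] -/
theorem curve_eq : kubertTateFive (((13 : ℤ) : ℚ)) (((3 : ℤ) : ℚ)) = ⟨-10, -39, -117, 0, 0⟩ := by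
  ext <;> simp [kubertTateFive] <;> norm_num

/-- `Δ(E_{13/3}) = -24270309531 = -3⁵·13⁵·269` (integer model). [cite: Kubert1976, Table 3 (N = 5)] -/
theorem Δ_int : (kubertTateFive (13 : ℤ) 3).Δ = -24270309531 := by
  rw [kubertTateFive_Δ]; norm_num

/-- `E_{13/3}` is an elliptic curve (`Δ ≠ 0`). [cite: Kubert1976, Table 3 (N = 5)] -/
theorem isElliptic : (kubertTateFive (((13 : ℤ) : ℚ)) (((3 : ℤ) : ℚ))).IsElliptic := by
  refine ⟨isUnit_iff_ne_zero.mpr ?_⟩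
  rw [eq_map_int (13) 3, map_Δ, Δ_int]
  norm_num

/-- `5 ∤ Δ`: good reduction at `5`. [cite: Fisher2001FiveSevenDescent, §2] -/
theorem not_five_dvd_Δ : ¬ (5 : ℤ) ∣ (kubertTateFive (13 : ℤ) 3).Δ := by
  rw [Δ_int]; norm_num

/-- `2 ∤ Δ`: good reduction at `2` (used for the rational torsion). [cite: SilvermanAEC2009, VII.3.1(b)] -/
theorem not_tor_dvd_Δ : ¬ ((2 : ℕ) : ℤ) ∣ (kubertTateFive (13 : ℤ) 3).Δ := by
  rw [Δ_int]; norm_num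

/-- **TAME**: every bad prime (`3, 13, 269`) is `≢ 1 (mod 5)`. [cite: Fisher2001FiveSevenDescent, §2] -/
theorem tame : ∀ p : ℕ, p.Prime → (p : ℤ) ∣ (kubertTateFive (13 : ℤ) 3).Δ → p % 5 ≠ 1 := by
  intro p hp hdvd
  rw [Δ_int] at hdvd
  have hdvdN : p ∣ 3 ^ 5 * 13 ^ 5 * 269 := by
    have h' : (p : ℤ) ∣ ((3 ^ 5 * 13 ^ 5 * 269 : ℕ) : ℤ) := by
      have e : ((3 ^ 5 * 13 ^ 5 * 269 : ℕ) : ℤ) = 24270309531 := by norm_num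
      rw [e]; exact (Int.dvd_neg.mpr hdvd)
    exact Int.natCast_dvd_natCast.mp h'
  have hpi := Nat.Prime.prime hp
  rcases hpi.dvd_or_dvd hdvdN with h | h
  · rcases hpi.dvd_or_dvd h with h | h
    · have := (Nat.prime_dvd_prime_iff_eq hp Nat.prime_three).mp (hpi.dvd_of_dvd_pow h); omega
    · have := (Nat.prime_dvd_prime_iff_eq hp (by norm_num : Nat.Prime 13)).mp (hpi.dvd_of_dvd_pow h); omega
  · have := (Nat.prime_dvd_prime_iff_eq hp (by norm_num : Nat.Prime 269)).mp h; omega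

/-- **GAUSSIAN-TAME**: every bad prime `ℓ` has `ℓ ≢ 1 (mod 5)` and `ℓ ≡ 4 (mod 5) ⇒ ℓ ≡ 1 (mod 4)`
(`269 ≡ 4 (mod 5)`, `269 ≡ 1 (mod 4)`). [cite: Fisher2001FiveSevenDescent, §2] -/
theorem gaussian_tame : ∀ p : ℕ, p.Prime → (p : ℤ) ∣ (kubertTateFive (13 : ℤ) 3).Δ →
    p % 5 ≠ 1 ∧ (p % 5 = 4 → p % 4 = 1) := by
  intro p hp hdvd
  refine ⟨tame p hp hdvd, fun h4 ↦ ?_⟩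
  rw [Δ_int] at hdvd
  have hdvdN : p ∣ 3 ^ 5 * 13 ^ 5 * 269 := by
    have h' : (p : ℤ) ∣ ((3 ^ 5 * 13 ^ 5 * 269 : ℕ) : ℤ) := by
      have e : ((3 ^ 5 * 13 ^ 5 * 269 : ℕ) : ℤ) = 24270309531 := by norm_num
      rw [e]; exact (Int.dvd_neg.mpr hdvd)
    exact Int.natCast_dvd_natCast.mp h'
  have hpi := Nat.Prime.prime hp
  rcases hpi.dvd_or_dvd hdvdN with h | h
  · rcases hpi.dvd_or_dvd h with h | h
    · have := (Nat.prime_dvd_prime_iff_eq hp Nat.prime_three).mp (hpi.dvd_of_dvd_pow h); omega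
    · have := (Nat.prime_dvd_prime_iff_eq hp (by norm_num : Nat.Prime 13)).mp (hpi.dvd_of_dvd_pow h); omega
  · have := (Nat.prime_dvd_prime_iff_eq hp (by norm_num : Nat.Prime 269)).mp h; omega

/-- `S = ` the prime factors of `|mn| = 39`: `{3, 13}`. [folklore] -/
private theorem primeFactors_eq : ((13 : ℤ) * 3).natAbs.primeFactors = {3, 13} := by
  have e : ((13 : ℤ) * 3).natAbs = 3 * 13 := by norm_num
  rw [e]
  ext p
  simp only [Nat.mem_primeFactors, Finset.mem_insert, Finset.mem_singleton]
  constructor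
  · rintro ⟨hp, hdvd, -⟩
    have hpi := Nat.Prime.prime hp
    rcases hpi.dvd_or_dvd hdvd with h | h
    · exact Or.inl ((Nat.prime_dvd_prime_iff_eq hp Nat.prime_three).mp h)
    · exact Or.inr ((Nat.prime_dvd_prime_iff_eq hp (by norm_num : Nat.Prime 13)).mp h)
  · rintro (rfl | rfl) <;> norm_num

/-! ## §2 The affine equation and the points -/

/-- The affine equation of `E_{13/3}`: `y ^ 2 - 10 * x * y - 117 * y = x ^ 3 - 39 * x ^ 2`. [cite: Kubert1976, Table 3 (N = 5)] -/
theorem nonsingular_iff (x y : ℚ) :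
    (kubertTateFive (((13 : ℤ) : ℚ)) (((3 : ℤ) : ℚ))).toAffine.Nonsingular x y ↔
      y ^ 2 - 10 * x * y - 117 * y = x ^ 3 - 39 * x ^ 2 := by
  have hΔ : (kubertTateFive (((13 : ℤ) : ℚ)) (((3 : ℤ) : ℚ))).Δ ≠ 0 := isElliptic.isUnit.ne_zero
  rw [← Affine.equation_iff_nonsingular_of_Δ_ne_zero hΔ, Affine.equation_iff]
  simp only [kubertTateFive_a₁, kubertTateFive_a₂, kubertTateFive_a₃, kubertTateFive_a₄,
    kubertTateFive_a₆]
  push_cast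
  constructor <;> intro h <;> linear_combination h

/-- The points `−T = (0, 117)`, `(105, 1617)` and the base point `2T = (39, 507)` lie on `E_{13/3}`. [folklore] -/
private theorem nonsingular_points :
    (kubertTateFive (((13 : ℤ) : ℚ)) (((3 : ℤ) : ℚ))).toAffine.Nonsingular 0 117 ∧
    (kubertTateFive (((13 : ℤ) : ℚ)) (((3 : ℤ) : ℚ))).toAffine.Nonsingular 105 1617 ∧
    (kubertTateFive (((13 : ℤ) : ℚ)) (((3 : ℤ) : ℚ))).toAffine.Nonsingular 39 507 := by
  refine ⟨(nonsingular_iff _ _).mpr ?_, (nonsingular_iff _ _).mpr ?_, (nonsingular_iff _ _).mpr ?_⟩ <;> norm_num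

/-! ## §3 The valuation matrix -/

/-- `v_p(± p^k u) = k` for `p ∤ u`. [folklore] -/
private theorem padicValRat_eq_of_eq {p : ℕ} [hp : Fact p.Prime] {a : ℚ} (k : ℕ) {u : ℕ} (s : ℤ)
    (hs : s = 1 ∨ s = -1) (hu : ¬ p ∣ u) (h : a = s * (p : ℚ) ^ k * u) : padicValRat p a = k := by
  have hu0 : u ≠ 0 := by rintro rfl; exact hu (dvd_zero p)
  have hp0 : (p : ℚ) ≠ 0 := Nat.cast_ne_zero.mpr hp.out.ne_zero
  have hs0 : (s : ℚ) ≠ 0 := by rcases hs with rfl | rfl <;> norm_num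
  have hsv : padicValRat p (s : ℚ) = 0 := by
    rcases hs with rfl | rfl
    · simp
    · rw [Int.cast_neg, Int.cast_one, padicValRat.neg, padicValRat.one]
  rw [h, padicValRat.mul (mul_ne_zero hs0 (pow_ne_zero _ hp0)) (Nat.cast_ne_zero.mpr hu0),
    padicValRat.mul hs0 (pow_ne_zero _ hp0), hsv, padicValRat.pow (p : ℚ),
    padicValRat.self hp.out.one_lt, padicValRat.of_nat, padicValNat.eq_zero_of_not_dvd hu]
  simp

/-- The `f_T`-values `f_T = xy − 3x² + 9y` of the points (`1053`, `151263`) and of the base point `2T` (`19773`).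
[cite: SilvermanAEC2009, Exercise 10.1(c)] -/
theorem kummerValues :
    (∀ i : Fin 2, ![(0 : ℚ), 105] i * ![(117 : ℚ), 1617] i - (((3 : ℤ) : ℚ)) * ![(0 : ℚ), 105] i ^ 2 +
      (((3 : ℤ) : ℚ)) ^ 2 * ![(117 : ℚ), 1617] i = ![(1053 : ℚ), 151263] i) ∧
    ((39 : ℚ) * 507 - (((3 : ℤ) : ℚ)) * (39) ^ 2 + (((3 : ℤ) : ℚ)) ^ 2 * 507 = (19773 : ℚ)) := by
  refine ⟨fun i ↦ ?_, by norm_num⟩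
  fin_cases i <;> simp <;> norm_num

/-- The valuations at `S = (3, 13)`: rows `[[4, 1], [2, 0]]` for the points and `[2, 3]` for the base point `2T`.
[cite: SilvermanAEC2009, Exercise 10.1(c)] -/
theorem valuations :
    (∀ i j : Fin 2, padicValRat (![3, 13] j) (![(1053 : ℚ), 151263] i) = ((![![4, 1], ![2, 0]] i j : ℕ) : ℤ)) ∧
    (∀ j : Fin 2, padicValRat (![3, 13] j) ((19773 : ℚ)) = ((![2, 3] j : ℕ) : ℤ)) := by
  haveI : Fact (Nat.Prime 3) := ⟨Nat.prime_three⟩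
  haveI : Fact (Nat.Prime 13) := ⟨by norm_num⟩
  refine ⟨fun i j ↦ ?_, fun j ↦ ?_⟩
  · fin_cases i <;> fin_cases j
    · exact padicValRat_eq_of_eq (p := 3) 4 (u := 13) (1) (Or.inl rfl) (by norm_num) (by norm_num)
    · exact padicValRat_eq_of_eq (p := 13) 1 (u := 81) (1) (Or.inl rfl) (by norm_num) (by norm_num)
    · exact padicValRat_eq_of_eq (p := 3) 2 (u := 16807) (1) (Or.inl rfl) (by norm_num) (by norm_num)
    · exact padicValRat_eq_of_eq (p := 13) 0 (u := 151263) (1) (Or.inl rfl) (by norm_num) (by norm_num)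
  · fin_cases j
    · exact padicValRat_eq_of_eq (p := 3) 2 (u := 2197) (1) (Or.inl rfl) (by norm_num) (by norm_num)
    · exact padicValRat_eq_of_eq (p := 13) 3 (u := 9) (1) (Or.inl rfl) (by norm_num) (by norm_num)

/-- **The valuation matrix mod `5` is invertible**: `M = [[2, 3], [0, 2]]` mod `5` and `[[3, 3], [0, 3]] · M = 1`. [folklore] -/
private theorem matrix_surjective : ∀ e : Fin 2 → ZMod 5, ∃ c : Fin 2 → ZMod 5, Matrix.vecMul c (Matrix.of (fun i j : Fin 2 ↦
      ((padicValRat (![3, 13] j) (![(0 : ℚ), 105] i * ![(117 : ℚ), 1617] i -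
          (((3 : ℤ) : ℚ)) * ![(0 : ℚ), 105] i ^ 2 + (((3 : ℤ) : ℚ)) ^ 2 * ![(117 : ℚ), 1617] i) -
        padicValRat (![3, 13] j) ((39 : ℚ) * 507 - (((3 : ℤ) : ℚ)) * (39) ^ 2 +
          (((3 : ℤ) : ℚ)) ^ 2 * 507) : ℤ) : ZMod 5))) = e := by
  have hM : Matrix.of (fun i j : Fin 2 ↦
      ((padicValRat (![3, 13] j) (![(0 : ℚ), 105] i * ![(117 : ℚ), 1617] i -
          (((3 : ℤ) : ℚ)) * ![(0 : ℚ), 105] i ^ 2 + (((3 : ℤ) : ℚ)) ^ 2 * ![(117 : ℚ), 1617] i) -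
        padicValRat (![3, 13] j) ((39 : ℚ) * 507 - (((3 : ℤ) : ℚ)) * (39) ^ 2 +
          (((3 : ℤ) : ℚ)) ^ 2 * 507) : ℤ) : ZMod 5)) = !![2, 3; 0, 2] := by
    ext i j
    simp only [Matrix.of_apply]
    rw [kummerValues.1 i, kummerValues.2, valuations.1 i j, valuations.2 j]
    fin_cases i <;> fin_cases j <;> decide
  have hinv : (!![3, 3; 0, 3] : Matrix (Fin 2) (Fin 2) (ZMod 5)) * !![2, 3; 0, 2] = 1 := by decide
  intro e
  refine ⟨Matrix.vecMul e !![3, 3; 0, 3], ?_⟩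
  rw [hM, Matrix.vecMul_vecMul, hinv, Matrix.vecMul_one]

/-- `S` is enumerated by `![3, 13]`. [folklore] -/
private theorem primeFactors_enum :
    (∀ j : Fin 2, ![3, 13] j ∈ ((13 : ℤ) * 3).natAbs.primeFactors) ∧
    (∀ p ∈ ((13 : ℤ) * 3).natAbs.primeFactors, ∃ j : Fin 2, ![3, 13] j = p) := by
  refine ⟨fun j ↦ ?_, fun p hp ↦ ?_⟩
  · rw [primeFactors_eq]; fin_cases j <;> simp
  · rw [primeFactors_eq] at hp
    simp only [Finset.mem_insert, Finset.mem_singleton] at hp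
    rcases hp with rfl | rfl
    · exact ⟨0, rfl⟩
    · exact ⟨1, rfl⟩

/-! ## §4 The theorems -/

/-- **`t₅(E_{13/3}) = 0`, UNCONDITIONALLY**, by the complete `5`-descent (tame régime, `2` points, rank `1`).
[cite: SilvermanAEC2009, Thm. X.4.2(a)] [cite: Fisher2001FiveSevenDescent, §2] -/
theorem shaCorank_five_eq_zero :
    haveI := isElliptic
    (kubertTateFive (((13 : ℤ) : ℚ)) (((3 : ℤ) : ℚ))).shaCorank 5 = 0 := by
  haveI := isElliptic
  haveI : Fact (Nat.Prime 2) := ⟨Nat.prime_two⟩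
  obtain ⟨h1, h2, hb⟩ := nonsingular_points
  exact KubertTateMuDescent.shaCorank_five_eq_zero_of_matrix (13) 3
    (toGeomPoints _ (.some 105 1617 h2)) (fun σ ↦ smul_toGeomPoints _ σ _)
    (KubertTateFiveTorsion.twentyfive_zsmul_toGeomPoints_ne_zero (13) 3 2 (by norm_num) (by norm_num)
      not_tor_dvd_Δ (by norm_num) (by norm_num))
    not_five_dvd_Δ tame ![3, 13] primeFactors_enum.1 primeFactors_enum.2
    ![0, 105] ![117, 1617]
    (fun i ↦ by fin_cases i <;> assumption)
    (fun i ↦ by fin_cases i <;> norm_num)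
    39 507 hb (by norm_num) matrix_surjective

/-- **`Ш(E_{13/3}/ℚ)[5] = 0`, unconditionally.** [cite: SilvermanAEC2009, Thm. X.4.2(a)] -/
theorem sha_torsionBy_five_eq_bot :
    haveI := isElliptic
    (kubertTateFive (((13 : ℤ) : ℚ)) (((3 : ℤ) : ℚ))).sha[((5 : ℕ) : ℤ)] = ⊥ := by
  haveI := isElliptic
  haveI : Fact (Nat.Prime 2) := ⟨Nat.prime_two⟩
  obtain ⟨h1, h2, hb⟩ := nonsingular_points
  exact KubertTateMuDescent.sha_torsionBy_five_eq_bot_of_matrix (13) 3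
    (toGeomPoints _ (.some 105 1617 h2)) (fun σ ↦ smul_toGeomPoints _ σ _)
    (KubertTateFiveTorsion.twentyfive_zsmul_toGeomPoints_ne_zero (13) 3 2 (by norm_num) (by norm_num)
      not_tor_dvd_Δ (by norm_num) (by norm_num))
    not_five_dvd_Δ tame ![3, 13] primeFactors_enum.1 primeFactors_enum.2
    ![0, 105] ![117, 1617]
    (fun i ↦ by fin_cases i <;> assumption)
    (fun i ↦ by fin_cases i <;> norm_num)
    39 507 hb (by norm_num) matrix_surjective

/-- **`Ш(E_{13/3}/ℚ)[5^∞] = 0`, unconditionally.** [cite: SilvermanAEC2009, Thm. X.4.2(a)] -/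
theorem primaryComponent_sha_five_eq_bot :
    haveI := isElliptic
    AddCommGroup.primaryComponent (kubertTateFive (((13 : ℤ) : ℚ)) (((3 : ℤ) : ℚ))).sha 5 = ⊥ := by
  haveI := isElliptic
  haveI : Fact (Nat.Prime 2) := ⟨Nat.prime_two⟩
  obtain ⟨h1, h2, hb⟩ := nonsingular_points
  exact KubertTateMuDescent.primaryComponent_sha_five_eq_bot_of_matrix (13) 3
    (toGeomPoints _ (.some 105 1617 h2)) (fun σ ↦ smul_toGeomPoints _ σ _)
    (KubertTateFiveTorsion.twentyfive_zsmul_toGeomPoints_ne_zero (13) 3 2 (by norm_num) (by norm_num)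
      not_tor_dvd_Δ (by norm_num) (by norm_num))
    not_five_dvd_Δ tame ![3, 13] primeFactors_enum.1 primeFactors_enum.2
    ![0, 105] ![117, 1617]
    (fun i ↦ by fin_cases i <;> assumption)
    (fun i ↦ by fin_cases i <;> norm_num)
    39 507 hb (by norm_num) matrix_surjective

/-- **`rank E_{13/3}(ℚ) = 1`, unconditionally** (the `5`-descent computes the rank: box full, tame,
`#E(ℚ)[5] = 5` by reduction modulo `2`). [cite: SilvermanAEC2009, Thm. X.4.2 and Thm. X.1.1] -/
theorem mordellWeilRank_eq :
    haveI := isElliptic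
    (kubertTateFive (((13 : ℤ) : ℚ)) (((3 : ℤ) : ℚ))).mordellWeilRank = 1 := by
  haveI := isElliptic
  haveI : Fact (Nat.Prime 2) := ⟨Nat.prime_two⟩
  obtain ⟨h1, h2, hb⟩ := nonsingular_points
  have h := KubertTateMuDescent.mordellWeilRank_succ_eq_of_matrix (13) 3
    (toGeomPoints _ (.some 105 1617 h2)) (fun σ ↦ smul_toGeomPoints _ σ _)
    (KubertTateFiveTorsion.twentyfive_zsmul_toGeomPoints_ne_zero (13) 3 2 (by norm_num) (by norm_num)
      not_tor_dvd_Δ (by norm_num) (by norm_num))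
    not_five_dvd_Δ tame ![3, 13] primeFactors_enum.1 primeFactors_enum.2
    ![0, 105] ![117, 1617]
    (fun i ↦ by fin_cases i <;> assumption)
    (fun i ↦ by fin_cases i <;> norm_num)
    39 507 hb (by norm_num) matrix_surjective
    (KubertTateFiveTorsion.natCard_torsionBy_five (13) 3 2 (by norm_num) (by norm_num) not_tor_dvd_Δ)
  have hc : (((13 : ℤ) * 3).natAbs.primeFactors).card = 2 := by
    rw [primeFactors_eq]; decide
  omega

end KubertTate133Descent

end Literature.NumberTheory.EllipticCurves

end
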